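import Mathlib
import Summits.Ventures.PercRepro2.TypedResidual

/-!
# The reduction spine relative to a HEREDITARY class of typed instances (blind cell PercRepro2,
mine-2 g42, 2026-08-29; `proofs/MINE2-SIXV.md` §1)

The spine of sub-claim S1 (`typedCount_nonneg_of_residual`, TypedResidual.lean) quantifies its
residual hypothesis over EVERY typed instance on the vertex and edge types.  For a class theorem
on small graphs one needs the hypothesis only on the instances the calculus can actually REACH
from the given one — and the calculus only ever shrinks the typed set and contracts pinned-open
edges (the contraction relabels the ends and the marks through `contractMap`).

* **`Hereditary P`** — a property of `(ends, marks, F)` closed under `F' ⊆ F` and under the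
  contraction of any pair `{u, v}` onto `u`;
* **`typedCount_nonneg_of_residual_hered`** — THE SPINE RELATIVE TO `P`: if row 2′TRI holds on
  the residual instances satisfying `P`, it holds on every instance satisfying `P` — the same
  strong induction on `redMeasure` with the same nine rules, `P` carried along.

The spine of record is the case `P = True`.  Own code; standard axioms; no `native_decide`.
-/

namespace Summit.Ventures.PercRepro2

open UnionCluster

namespace CovForm

namespace TypedRed

open Contract Untouched

section Hereditary

variable {V : Type*} {E : Type*} [DecidableEq V] [Fintype E] [DecidableEq E]

/-- **A hereditary class of typed instances**: closed under shrinking the typed set and under the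
contraction of a pair of vertices `{u, v}` onto `u` (ends and marks relabelled by `contractMap`). -/
structure Hereditary (P : (E → Sym2 V) → V → V → V → V → V → Finset E → Prop) : Prop where
  /-- closed under `F' ⊆ F` -/
  mono : ∀ (ends : E → Sym2 V) (o a₁ a₂ a₃ b : V) (F F' : Finset E), F' ⊆ F →
    P ends o a₁ a₂ a₃ b F → P ends o a₁ a₂ a₃ b F'
  /-- closed under contraction of `{u, v}` onto `u` -/
  contract : ∀ (ends : E → Sym2 V) (o a₁ a₂ a₃ b : V) (F : Finset E) (u v : V),
    P ends o a₁ a₂ a₃ b F →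
      P (contractEnds ends {u, v} u) (contractMap {u, v} u o) (contractMap {u, v} u a₁)
        (contractMap {u, v} u a₂) (contractMap {u, v} u a₃) (contractMap {u, v} u b) F

variable {R : Type*} [Field R] [LinearOrder R] [IsStrictOrderedRing R]

/-- **THE REDUCTION SPINE RELATIVE TO A HEREDITARY CLASS**: if row 2′TRI holds on the residual
instances of the class `P`, it holds on every instance of the class — by strong induction on the
reduction measure, each rule of the calculus (contraction, pinned loop, root pair, typed loop,
unmarked leaf, pendant `b` / `o`, parallel, series) rewriting the typed count by its landed
identity into counts of smaller measure that stay in the class, and the base `Base5U4`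
discharged as in the spine of record. -/
theorem typedCount_nonneg_of_residual_hered
    {P : (E → Sym2 V) → V → V → V → V → V → Finset E → Prop} (hP : Hereditary P)
    (hNR : ∀ (ends : E → Sym2 V) (o a₁ a₂ a₃ b : V) (F : Finset E) (τ : E → ℕ),
      (∀ e ∈ F, τ e = 1 ∨ τ e = 2) → Residual ends o a₁ a₂ a₃ b F → P ends o a₁ a₂ a₃ b F →
        0 ≤ typedCount F (fun _ => false) τ
          (K3 ends o a₁ a₂ a₃ b : Config E → Config E → Config E → R))
    (ends : E → Sym2 V) (o a₁ a₂ a₃ b : V) (F : Finset E) (z : Config E) (τ : E → ℕ)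
    (hτ : ∀ e ∈ F, τ e = 1 ∨ τ e = 2) (hF : P ends o a₁ a₂ a₃ b F) :
    0 ≤ typedCount F z τ (K3 ends o a₁ a₂ a₃ b : Config E → Config E → Config E → R) := by
  generalize hn : redMeasure ends F z = n
  induction n using Nat.strong_induction_on generalizing ends o a₁ a₂ a₃ b F z τ with
  | _ n ih =>
  -- the base, then the rules in the order contraction, pinned loop, root pair, typed loop,
  -- unmarked leaf, pendant `b`, pendant `o`, parallel, series; last the residual case
  by_cases hB : Base5U4 ends o a₁ a₂ a₃ b F z τ
  · exact typedCount_nonneg_of_base5U4 ends o a₁ a₂ a₃ b F z τ hB hτ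
  by_cases hc : ∃ g, g ∉ F ∧ z g = true ∧ ¬ (ends g).IsDiag
  · obtain ⟨g, hgF, hz, hnd⟩ := hc
    obtain ⟨⟨u, v⟩, huv⟩ := Quot.exists_rep (ends g)
    have hg : ends g = s(u, v) := huv.symm
    have huv' : u ≠ v := by
      intro h
      apply hnd
      rw [hg, Sym2.mk_isDiag_iff]
      exact h
    rw [typedCount_contract_open ends o a₁ a₂ a₃ b hg F hgF z hz τ]
    exact ih _ (by rw [← hn]; exact redMeasure_contract_lt ends hg huv' hgF hz) _ _ _ _ _ _ F z τ
      hτ (hP.contract ends o a₁ a₂ a₃ b F u v hF) rfl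
  by_cases hl : ∃ g, g ∉ F ∧ z g = true ∧ (ends g).IsDiag
  · obtain ⟨g, hgF, hz, hd⟩ := hl
    obtain ⟨⟨u, v⟩, huv⟩ := Quot.exists_rep (ends g)
    have hg : ends g = s(u, v) := huv.symm
    have huv' : u = v := by
      rw [hg, Sym2.mk_isDiag_iff] at hd
      exact hd
    subst huv'
    rw [typedCount_pinned_loop ends o a₁ a₂ a₃ b hg F hgF z hz τ]
    exact ih _ (by rw [← hn]; exact redMeasure_update_closed_lt ends hgF hz) _ _ _ _ _ _ F _ τ
      hτ hF rfl
  by_cases hr : ∃ f ∈ F, ends f = s(a₁, a₂)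
  · obtain ⟨f, hfF, hf⟩ := hr
    have h1 : 1 ≤ τ f := by rcases hτ f hfF with h | h <;> omega
    rw [typedCount_root_pair ends o a₁ a₂ a₃ b hf F hfF z τ h1]
  by_cases htl : ∃ f ∈ F, (ends f).IsDiag
  · obtain ⟨f, hfF, hd⟩ := htl
    obtain ⟨⟨u, v⟩, huv⟩ := Quot.exists_rep (ends f)
    have hf : ends f = s(u, v) := huv.symm
    have huv' : u = v := by
      rw [hf, Sym2.mk_isDiag_iff] at hd
      exact hd
    subst huv'
    rw [typedCount_loop ends o a₁ a₂ a₃ b hf F hfF z τ,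
      typedCount_type_zero F _ hfF z _ (Function.update_self _ _ _),
      typedCount_congr_τ (F.erase _) _ (τ' := τ)
        (fun e he => Function.update_of_ne (Finset.ne_of_mem_erase he) _ _)]
    exact mul_nonneg (Nat.cast_nonneg _)
      (ih _ (by rw [← hn]; exact redMeasure_erase_update_lt ends hfF z false) _ _ _ _ _ _ _ _ τ
        (fun e he => hτ e (Finset.mem_of_mem_erase he))
        (hP.mono ends o a₁ a₂ a₃ b F _ (Finset.erase_subset _ _) hF) rfl)
  by_cases hleaf : ∃ f ∈ F, ∃ l u : V, ends f = s(l, u) ∧ l ≠ u ∧ l ≠ o ∧ l ≠ a₁ ∧ l ≠ a₂ ∧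
      l ≠ a₃ ∧ l ≠ b ∧ (∀ e', e' ≠ f → l ∈ ends e' → e' ∉ F ∧ z e' = false)
  · obtain ⟨f, hfF, l, u, hf, hlu, hlo, hl1, hl2, hl3, hlb, hcl⟩ := hleaf
    rw [typedCount_unmarked_leaf' ends o a₁ a₂ a₃ b hf hlu hlo hl1 hl2 hl3 hlb F hfF z τ hcl,
      typedCount_type_zero F _ hfF z _ (Function.update_self _ _ _),
      typedCount_congr_τ (F.erase _) _ (τ' := τ)
        (fun e he => Function.update_of_ne (Finset.ne_of_mem_erase he) _ _)]
    exact mul_nonneg (Nat.cast_nonneg _)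
      (ih _ (by rw [← hn]; exact redMeasure_erase_update_lt ends hfF z false) _ _ _ _ _ _ _ _ τ
        (fun e he => hτ e (Finset.mem_of_mem_erase he))
        (hP.mono ends o a₁ a₂ a₃ b F _ (Finset.erase_subset _ _) hF) rfl)
  by_cases hpb : ∃ f ∈ F, ∃ u : V, ends f = s(b, u) ∧ b ≠ u ∧ b ≠ o ∧ b ≠ a₁ ∧ b ≠ a₂ ∧
      b ≠ a₃ ∧ (∀ e', e' ≠ f → b ∈ ends e' → e' ∉ F ∧ z e' = false)
  · obtain ⟨f, hfF, u, hf, hbu, hbo, hb1, hb2, hb3, hcl⟩ := hpb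
    have h1 : 1 ≤ τ f := by rcases hτ f hfF with h | h <;> omega
    rw [typedCount_pendant_b' ends o a₁ a₂ a₃ b hf hbu hbo hb1 hb2 hb3 F hfF z τ h1 hcl,
      typedCount_type_three F _ hfF z _ (Function.update_self _ _ _),
      typedCount_congr_τ (F.erase _) _ (τ' := τ)
        (fun e he => Function.update_of_ne (Finset.ne_of_mem_erase he) _ _)]
    exact mul_nonneg (Nat.cast_nonneg _)
      (ih _ (by rw [← hn]; exact redMeasure_erase_update_lt ends hfF z true) _ _ _ _ _ _ _ _ τ
        (fun e he => hτ e (Finset.mem_of_mem_erase he))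
        (hP.mono ends o a₁ a₂ a₃ b F _ (Finset.erase_subset _ _) hF) rfl)
  by_cases hpo : ∃ f ∈ F, ∃ u : V, ends f = s(o, u) ∧ o ≠ u ∧ o ≠ a₁ ∧ o ≠ a₂ ∧ o ≠ a₃ ∧
      o ≠ b ∧ (∀ e', e' ≠ f → o ∈ ends e' → e' ∉ F ∧ z e' = false)
  · obtain ⟨f, hfF, u, hf, hou, ho1, ho2, ho3, hob, hcl⟩ := hpo
    have h1 : 1 ≤ τ f := by rcases hτ f hfF with h | h <;> omega
    rw [typedCount_pendant_o' ends o a₁ a₂ a₃ b hf hou ho1 ho2 ho3 hob F hfF z τ h1 hcl,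
      typedCount_type_three F _ hfF z _ (Function.update_self _ _ _),
      typedCount_congr_τ (F.erase _) _ (τ' := τ)
        (fun e he => Function.update_of_ne (Finset.ne_of_mem_erase he) _ _)]
    exact mul_nonneg (Nat.cast_nonneg _)
      (ih _ (by rw [← hn]; exact redMeasure_erase_update_lt ends hfF z true) _ _ _ _ _ _ _ _ τ
        (fun e he => hτ e (Finset.mem_of_mem_erase he))
        (hP.mono ends o a₁ a₂ a₃ b F _ (Finset.erase_subset _ _) hF) rfl)
  by_cases hpar : ∃ e ∈ F, ∃ f ∈ F, e ≠ f ∧ ends e = ends f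
  · obtain ⟨e, heF, f, hfF, hef, hpar⟩ := hpar
    have heF' : e ∈ F.erase f := Finset.mem_erase.2 ⟨hef, heF⟩
    rw [typedCount_parallel ends o a₁ a₂ a₃ b hef hpar F heF hfF z τ (hτ e heF) (hτ f hfF),
      Finset.sum_range_succ, Finset.sum_range_succ, Finset.sum_range_succ, Finset.sum_range_succ,
      Finset.sum_range_zero, zero_add, muOr_zero _ _ (hτ e heF) (hτ f hfF), Nat.cast_zero, zero_mul,
      zero_add]
    have hτ' : ∀ j, ∀ e' ∈ F.erase f, e' ≠ e →
        Function.update τ e j e' = 1 ∨ Function.update τ e j e' = 2 := by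
      intro j e' he' hne
      rw [Function.update_of_ne hne]
      exact hτ e' (Finset.mem_of_mem_erase he')
    have hlt1 : redMeasure ends (F.erase f) (Function.update z f false) < n := by
      rw [← hn]; exact redMeasure_erase_update_lt ends hfF z false
    have hF1 : P ends o a₁ a₂ a₃ b (F.erase f) :=
      hP.mono ends o a₁ a₂ a₃ b F _ (Finset.erase_subset _ _) hF
    refine add_nonneg (add_nonneg (mul_nonneg (Nat.cast_nonneg _) ?_)
      (mul_nonneg (Nat.cast_nonneg _) ?_)) (mul_nonneg (Nat.cast_nonneg _) ?_)
    · refine ih _ hlt1 _ _ _ _ _ _ _ _ _ (fun e' he' => ?_) hF1 rfl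
      by_cases hne : e' = e
      · subst hne; rw [Function.update_self]; exact Or.inl rfl
      · exact hτ' 1 e' he' hne
    · refine ih _ hlt1 _ _ _ _ _ _ _ _ _ (fun e' he' => ?_) hF1 rfl
      by_cases hne : e' = e
      · subst hne; rw [Function.update_self]; exact Or.inr rfl
      · exact hτ' 2 e' he' hne
    · rw [typedCount_type_three (F.erase f) e heF' _ _ (Function.update_self _ _ _),
        typedCount_congr_τ ((F.erase f).erase e) _ (τ' := τ)
          (fun e' he' => Function.update_of_ne (Finset.ne_of_mem_erase he') _ _)]
      refine ih _ ?_ _ _ _ _ _ _ _ _ τ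
        (fun e' he' => hτ e' (Finset.mem_of_mem_erase (Finset.mem_of_mem_erase he')))
        (hP.mono ends o a₁ a₂ a₃ b _ _ (Finset.erase_subset _ _) hF1) rfl
      exact (redMeasure_erase_update_lt ends heF' _ true).trans hlt1
  by_cases hser : ∃ e ∈ F, ∃ f ∈ F, e ≠ f ∧ ∃ u w v : V, ends e = s(u, w) ∧ ends f = s(w, v) ∧
      w ≠ u ∧ w ≠ v ∧ w ≠ o ∧ w ≠ a₁ ∧ w ≠ a₂ ∧ w ≠ a₃ ∧ w ≠ b ∧
      (∀ e', e' ≠ e → e' ≠ f → w ∈ ends e' → e' ∉ F ∧ z e' = false)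
  · obtain ⟨e, heF, f, hfF, hef, u, w, v, he, hf, hwu, hwv, hwo, hw1, hw2, hw3, hwb, hcl⟩ := hser
    have heF' : e ∈ F.erase f := Finset.mem_erase.2 ⟨hef, heF⟩
    rw [typedCount_series ends o a₁ a₂ a₃ b hef he hf hwu hwv hwo hw1 hw2 hw3 hwb F heF hfF z τ
        (hτ e heF) (hτ f hfF) hcl,
      Finset.sum_range_succ, Finset.sum_range_succ, Finset.sum_range_succ, Finset.sum_range_succ,
      Finset.sum_range_zero, zero_add, muAnd_three _ _ (hτ e heF) (hτ f hfF), Nat.cast_zero,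
      zero_mul, add_zero]
    have hτ' : ∀ j, ∀ e' ∈ F.erase f, e' ≠ e →
        Function.update τ e j e' = 1 ∨ Function.update τ e j e' = 2 := by
      intro j e' he' hne
      rw [Function.update_of_ne hne]
      exact hτ e' (Finset.mem_of_mem_erase he')
    have hlt1 : redMeasure ends (F.erase f) (Function.update z f true) < n := by
      rw [← hn]; exact redMeasure_erase_update_lt ends hfF z true
    have hF1 : P ends o a₁ a₂ a₃ b (F.erase f) :=
      hP.mono ends o a₁ a₂ a₃ b F _ (Finset.erase_subset _ _) hF
    refine add_nonneg (add_nonneg (mul_nonneg (Nat.cast_nonneg _) ?_)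
      (mul_nonneg (Nat.cast_nonneg _) ?_)) (mul_nonneg (Nat.cast_nonneg _) ?_)
    · rw [typedCount_type_zero (F.erase f) e heF' _ _ (Function.update_self _ _ _),
        typedCount_congr_τ ((F.erase f).erase e) _ (τ' := τ)
          (fun e' he' => Function.update_of_ne (Finset.ne_of_mem_erase he') _ _)]
      refine ih _ ?_ _ _ _ _ _ _ _ _ τ
        (fun e' he' => hτ e' (Finset.mem_of_mem_erase (Finset.mem_of_mem_erase he')))
        (hP.mono ends o a₁ a₂ a₃ b _ _ (Finset.erase_subset _ _) hF1) rfl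
      exact (redMeasure_erase_update_lt ends heF' _ false).trans hlt1
    · refine ih _ hlt1 _ _ _ _ _ _ _ _ _ (fun e' he' => ?_) hF1 rfl
      by_cases hne : e' = e
      · subst hne; rw [Function.update_self]; exact Or.inl rfl
      · exact hτ' 1 e' he' hne
    · refine ih _ hlt1 _ _ _ _ _ _ _ _ _ (fun e' he' => ?_) hF1 rfl
      by_cases hne : e' = e
      · subst hne; rw [Function.update_self]; exact Or.inr rfl
      · exact hτ' 2 e' he' hne
  -- no rule applies and the instance is not in the base: it is residual
  have hz0 : ∀ g, g ∉ F → z g = false := by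
    intro g hgF
    by_contra hz
    have hz' : z g = true := by
      cases h : z g
      · exact absurd h hz
      · rfl
    by_cases hd : (ends g).IsDiag
    · exact hl ⟨g, hgF, hz', hd⟩
    · exact hc ⟨g, hgF, hz', hd⟩
  have hRed : Reduced ends o a₁ a₂ a₃ b F :=
    { no_root_pair := fun f hfF hf => hr ⟨f, hfF, hf⟩
      no_loop := fun f hfF hd => htl ⟨f, hfF, hd⟩
      no_parallel := fun e heF f hfF hef hp => hpar ⟨e, heF, f, hfF, hef, hp⟩
      no_leaf := fun f hfF l u hf hlu hlo hl1 hl2 hl3 hlb => by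
        by_contra hno
        refine hleaf ⟨f, hfF, l, u, hf, hlu, hlo, hl1, hl2, hl3, hlb, fun e' hne hl' => ?_⟩
        have hnF : e' ∉ F := fun hF => hno ⟨e', hF, hne, hl'⟩
        exact ⟨hnF, hz0 e' hnF⟩
      no_pendant_b := fun f hfF u hf hbu hbo hb1 hb2 hb3 => by
        by_contra hno
        refine hpb ⟨f, hfF, u, hf, hbu, hbo, hb1, hb2, hb3, fun e' hne hb' => ?_⟩
        have hnF : e' ∉ F := fun hF => hno ⟨e', hF, hne, hb'⟩
        exact ⟨hnF, hz0 e' hnF⟩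
      no_pendant_o := fun f hfF u hf hou ho1 ho2 ho3 hob => by
        by_contra hno
        refine hpo ⟨f, hfF, u, hf, hou, ho1, ho2, ho3, hob, fun e' hne ho' => ?_⟩
        have hnF : e' ∉ F := fun hF => hno ⟨e', hF, hne, ho'⟩
        exact ⟨hnF, hz0 e' hnF⟩
      no_series := fun e heF f hfF hef u w v he hf hwu hwv hwo hw1 hw2 hw3 hwb => by
        by_contra hno
        refine hser ⟨e, heF, f, hfF, hef, u, w, v, he, hf, hwu, hwv, hwo, hw1, hw2, hw3, hwb,
          fun e' hne hnf hw' => ?_⟩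
        have hnF : e' ∉ F := fun hF => hno ⟨e', hF, hne, hnf, hw'⟩
        exact ⟨hnF, hz0 e' hnF⟩ }
  have hRes : Residual ends o a₁ a₂ a₃ b F := by
    have h5 : ¬ F.card ≤ 5 := fun h => hB (Or.inl h)
    have h1 : ¬ UntouchedBy ends F z a₁ := fun h => hB (Or.inr (Or.inl h))
    have h2 : ¬ UntouchedBy ends F z a₂ := fun h => hB (Or.inr (Or.inr (Or.inl h)))
    have ho : ¬ UntouchedBy ends F z o := fun h => hB (Or.inr (Or.inr (Or.inr (Or.inl h))))
    have hb : ¬ UntouchedBy ends F z b := fun h => hB (Or.inr (Or.inr (Or.inr (Or.inr h))))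
    have key : ∀ v : V, ¬ UntouchedBy ends F z v → ∃ e ∈ F, v ∈ ends e := by
      intro v hU
      by_contra hno
      exact hU fun e he ht => hno (exists_mem_ends_of_touches hz0 he ht)
    exact ⟨hRed, by omega, key a₁ h1, key a₂ h2, key o ho, key b hb⟩
  rw [typedCount_congr_z F (z' := fun _ => false) (fun e he => hz0 e he) τ]
  exact hNR ends o a₁ a₂ a₃ b F τ hτ hRes hF

/-- **`TypedBases` from (TRI) on the residual instances of a hereditary class containing the
typed sets of the instance** (every typed set `F` lies in the class). -/
theorem TypedBases_of_residual_hered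
    {P : (E → Sym2 V) → V → V → V → V → V → Finset E → Prop} (hP : Hereditary P)
    (hNR : ∀ (ends : E → Sym2 V) (o a₁ a₂ a₃ b : V) (F : Finset E) (τ : E → ℕ),
      (∀ e ∈ F, τ e = 1 ∨ τ e = 2) → Residual ends o a₁ a₂ a₃ b F → P ends o a₁ a₂ a₃ b F →
        0 ≤ typedCount F (fun _ => false) τ
          (K3 ends o a₁ a₂ a₃ b : Config E → Config E → Config E → R))
    (ends : E → Sym2 V) (o a₁ a₂ a₃ b : V) (hall : ∀ F : Finset E, P ends o a₁ a₂ a₃ b F) :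
    TypedBases (R := R) ends o a₁ a₂ a₃ b :=
  fun F z τ hτ => typedCount_nonneg_of_residual_hered hP hNR ends o a₁ a₂ a₃ b F z τ hτ (hall F)

omit [Fintype E] [DecidableEq E] in
/-- The spine of record is the hereditary spine for the class of every instance. -/
theorem hereditary_true : Hereditary (fun (_ : E → Sym2 V) (_ _ _ _ _ : V) (_ : Finset E) => True) :=
  ⟨fun _ _ _ _ _ _ _ _ _ _ => trivial, fun _ _ _ _ _ _ _ _ _ _ => trivial⟩

end Hereditary

end TypedRed

end CovForm

end Summit.Ventures.PercRepro2
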